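import Mathlib
import Summits.AnomalousDissipation.AnomalousDissipation.Theorems.MarginalStabilityChainBurgersLayerKHStubSheetLimitC

/-!
# The vortex-sheet limit of the Rayleigh sheet coefficient (stub `stub_sheetLimit`, line `Sketch`)

Crux `MarginalStabilityChain.BurgersLayerKH` (stmt-AnomalousDissipation-3008), line `Sketch`, registered stub

  `stub_sheetLimit : (∀ k, 1 ≤ k → ∀ A, VolterraPackage k A) → ∀ C₀, 0 < C₀ → ∀ ε, 0 < ε → SheetLimitPackage C₀ ε`

(the vortex-sheet / long-wave limit of the Rayleigh sheet coefficient, Drazin–Reid §23 made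
quantitative).  ROUTE (an exact Wronskian identity + a zeroth-order Jost comparison; no second-order
expansion is needed).  For a slow mode `ψ` at `h = 0` put `m = e^{αy}ψ`, `V = iU''/(λ + iU)`, so that
`m'' = 2αm' + Vm`, `m → 1` at `+∞`, `‖m‖ ≤ C₀(1+|y|)`, and `a := sheetCoeff α ψ = 1 + (2α)⁻¹∫Vm`.
Since `u₁ = λ + iU` solves `u₁'' = V u₁`, integrating the two exact derivatives
`(m' - 2αm)' = Vm` and `(u₁(m' - 2αm) - iU'm)' = -2αi U'm` over `ℝ` gives the IDENTITY

  `a (λ - iU₊) = (λ + iU₊) - i ∫ U' m`,            `U₊ = U(+∞) = √(π/2)`,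

while for `m₀ = (λ + iU)/(λ + iU₊)` (the `α = 0` Jost function, `m₀ = 1 + K₀[V m₀]`) one has
`∫ U' m₀ = 2λU₊/(λ + iU₊)` and `sheetEvans λ (λ - iU₊) = (λ + iU₊) - i ∫ U' m₀`.  Hence
`a - sheetEvans λ = -i ∫ U'(m - m₀)/(λ - iU₊)`, and `‖m - m₀‖ ≤ α K (1+|y|)²` by the weighted
Volterra theory (`VolterraPackage 2 A` at `α`-slot `0`: `m - m₀ = (K_α - K₀)[Vm] + K₀[V(m - m₀)]`
with `|k_α(u) - u| ≤ αu²`), so `‖a - sheetEvans λ‖ ≤ α · const(C₀) ≤ ε` for `α ≤ α₁(C₀, ε)`.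

This file: the `O(α)` perturbation bound `‖m - m₀‖ ≤ αK(1+|y|)²` from `VolterraPackage 2 A`
(uniqueness + scaling at `α`-slot `0`, source `(K_α - K₀)[Vm]` of size `α A C₀ M₃ (1+|y|)²`), and the
registered stub `stub_sheetLimit` (assembly of parts A–C).
-/

set_option linter.dupNamespace false

noncomputable section

open Complex MeasureTheory Filter Topology Set Metric

namespace Summit.AnomalousDissipation.AnomalousDissipation.Theorems.BurgersLayerKH.Sheet.SheetLimit

/-! ## D1. Weighted integrability of the Volterra integrands -/

/-- `V f` and `t V f` are integrable for Gaussian `V` and polynomially bounded continuous `f`. [folklore] -/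
theorem integrable_V_mul {A B : ℝ} {V f : ℝ → ℂ} (hVc : Continuous V)
    (hV : ∀ t, ‖V t‖ ≤ A * Real.exp (-(t ^ 2) / 4)) (hf : Continuous f) {k : ℕ}
    (hfb : ∀ t, ‖f t‖ ≤ B * (1 + |t|) ^ k) :
    Integrable (fun t => V t * f t) ∧ Integrable (fun t : ℝ => (t : ℂ) * (V t * f t)) := by
  have hA : 0 ≤ A := by
    have := (norm_nonneg _).trans (hV 0); simpa using this
  have h1 : ∀ t, ‖V t * f t‖ ≤ A * B * ((1 + |t|) ^ k * Real.exp (0 * t) * Real.exp (-(t ^ 2) / 4)) := by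
    intro t
    rw [norm_mul, zero_mul, Real.exp_zero, mul_one]
    have hB : 0 ≤ B * (1 + |t|) ^ k := (norm_nonneg _).trans (hfb t)
    calc ‖V t‖ * ‖f t‖ ≤ (A * Real.exp (-(t ^ 2) / 4)) * (B * (1 + |t|) ^ k) :=
          mul_le_mul (hV t) (hfb t) (norm_nonneg _) (by positivity)
      _ = _ := by ring
  refine ⟨integrable_of_norm_le_polyGauss (hVc.mul hf).aestronglyMeasurable _ _ _ h1,
    integrable_of_norm_le_polyGauss (continuous_ofReal.mul (hVc.mul hf)).aestronglyMeasurable (A * B)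
      (k + 1) 0 fun t => ?_⟩
  rw [norm_mul, Complex.norm_real, Real.norm_eq_abs]
  have hB : 0 ≤ B * (1 + |t|) ^ k := (norm_nonneg _).trans (hfb t)
  calc |t| * ‖V t * f t‖ ≤ (1 + |t|) * (A * B * ((1 + |t|) ^ k * Real.exp (0 * t) * Real.exp (-(t ^ 2) / 4))) :=
        mul_le_mul (by linarith [abs_nonneg t]) (h1 t) (norm_nonneg _) (by positivity)
    _ = _ := by ring

/-- The Volterra integrand `k_α(t-y) V(t) f(t)` is integrable on `(y, ∞)`. [folklore] -/
theorem integrableOn_kernel_mul {α A B : ℝ} (hα : 0 ≤ α) {V f : ℝ → ℂ} (hVc : Continuous V)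
    (hV : ∀ t, ‖V t‖ ≤ A * Real.exp (-(t ^ 2) / 4)) (hf : Continuous f) {k : ℕ}
    (hfb : ∀ t, ‖f t‖ ≤ B * (1 + |t|) ^ k) (y : ℝ) :
    IntegrableOn (fun t => (volterraKernel α (t - y) : ℂ) * V t * f t) (Ioi y) := by
  obtain ⟨-, i1⟩ := integrable_V_mul hVc hV hf hfb
  have hmaj : Integrable fun t : ℝ => (1 + |y|) * (‖V t * f t‖ + ‖(t : ℂ) * (V t * f t)‖) :=
    (((integrable_V_mul hVc hV hf hfb).1.norm).add i1.norm).const_mul _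
  refine Integrable.mono' (hmaj.integrableOn (s := Ioi y)).integrable ?_ ?_
  · exact ((continuous_ofReal.comp ((Volterra.continuous_volterraKernel α).comp
      (continuous_id.sub continuous_const))).mul hVc |>.mul hf).aestronglyMeasurable
  · refine (ae_restrict_iff' measurableSet_Ioi).2 (Eventually.of_forall fun t ht => ?_)
    have hkb := volterraKernel_bounds hα (sub_nonneg.2 (le_of_lt ht))
    have e : ‖(t : ℂ) * (V t * f t)‖ = |t| * ‖V t * f t‖ := by
      rw [norm_mul, Complex.norm_real, Real.norm_eq_abs]
    rw [mul_assoc, norm_mul, Complex.norm_real, Real.norm_of_nonneg hkb.1, e]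
    have hn := norm_nonneg (V t * f t)
    calc volterraKernel α (t - y) * ‖V t * f t‖ ≤ (t - y) * ‖V t * f t‖ := by gcongr; exact hkb.2.1
      _ ≤ (1 + |y|) * (‖V t * f t‖ + |t| * ‖V t * f t‖) := by
          nlinarith [le_abs_self t, neg_abs_le y, abs_nonneg t, abs_nonneg y, mul_nonneg (abs_nonneg y) hn,
            mul_nonneg (mul_nonneg (abs_nonneg y) (abs_nonneg t)) hn]

/-- `y ↦ K₀[V f](y) = ∫_{t>y} (t-y) V f` is continuous. [folklore] -/
theorem continuous_K0 {A B : ℝ} {V f : ℝ → ℂ} (hVc : Continuous V)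
    (hV : ∀ t, ‖V t‖ ≤ A * Real.exp (-(t ^ 2) / 4)) (hf : Continuous f) {k : ℕ}
    (hfb : ∀ t, ‖f t‖ ≤ B * (1 + |t|) ^ k) :
    Continuous fun y => ∫ t in Ioi y, (volterraKernel 0 (t - y) : ℂ) * V t * f t := by
  obtain ⟨i0, i1⟩ := integrable_V_mul hVc hV hf hfb
  have e : ∀ y, ∫ t in Ioi y, (volterraKernel 0 (t - y) : ℂ) * V t * f t =
      (∫ t in Ioi y, (t : ℂ) * (V t * f t)) - (y : ℂ) * ∫ t in Ioi y, V t * f t := by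
    intro y
    rw [← integral_const_mul, ← integral_sub i1.integrableOn (i0.const_mul _).integrableOn]
    refine setIntegral_congr_fun measurableSet_Ioi (fun t _ => ?_)
    simp only [volterraKernel, ↓reduceIte, Complex.ofReal_sub]
    ring
  rw [show (fun y => ∫ t in Ioi y, (volterraKernel 0 (t - y) : ℂ) * V t * f t) = _ from funext e]
  exact (continuous_integral_Ioi i1).sub (continuous_ofReal.mul (continuous_integral_Ioi i0))

/-- The kernel-difference term is `O(α)` with quadratic weight:
`‖∫_{t>y} (k_α - k_0)(t-y) V m‖ ≤ α A C₀ M₃ (1+|y|)²`. [folklore] -/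
theorem norm_kernel_diff_le {α A C₀ : ℝ} (hα : 0 ≤ α) {V m : ℝ → ℂ}
    (hV : ∀ t, ‖V t‖ ≤ A * Real.exp (-(t ^ 2) / 4)) (hmb : ∀ t, ‖m t‖ ≤ C₀ * (1 + |t|)) (y : ℝ) :
    ‖∫ t in Ioi y, ((volterraKernel α (t - y) : ℂ) - (volterraKernel 0 (t - y) : ℂ)) * V t * m t‖ ≤
      α * (A * C₀ * ∫ t, (1 + |t|) ^ 3 * Real.exp (0 * t) * Real.exp (-(t ^ 2) / 4)) * (1 + |y|) ^ 2 := by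
  have hA : 0 ≤ A := by
    have := (norm_nonneg _).trans (hV 0); simpa using this
  have hC₀ : 0 ≤ C₀ := by
    have := (norm_nonneg _).trans (hmb 0); simpa using this
  set g : ℝ → ℝ := fun t => α * (A * C₀) * (1 + |y|) ^ 2 *
    ((1 + |t|) ^ 3 * Real.exp (0 * t) * Real.exp (-(t ^ 2) / 4)) with hg
  have ig : Integrable g := (integrable_polyGauss 3 0).const_mul _
  have hle : ∀ t ∈ Ioi y, ‖((volterraKernel α (t - y) : ℂ) - (volterraKernel 0 (t - y) : ℂ)) * V t * m t‖ ≤ g t := by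
    intro t ht
    have hu : 0 ≤ t - y := sub_nonneg.2 (le_of_lt ht)
    have hkb := (volterraKernel_bounds hα hu).2.2
    have hk0 : volterraKernel 0 (t - y) = t - y := by simp [volterraKernel]
    rw [norm_mul, norm_mul, ← Complex.ofReal_sub, Complex.norm_real, Real.norm_eq_abs, hk0]
    have h1 : (t - y) ^ 2 ≤ ((1 + |y|) * (1 + |t|)) ^ 2 := by
      apply pow_le_pow_left₀ hu
      nlinarith [le_abs_self t, neg_abs_le y, abs_nonneg t, abs_nonneg y]
    have h2 : ‖V t‖ * ‖m t‖ ≤ (A * Real.exp (-(t ^ 2) / 4)) * (C₀ * (1 + |t|)) :=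
      mul_le_mul (hV t) (hmb t) (norm_nonneg _) (by positivity)
    calc |volterraKernel α (t - y) - (t - y)| * ‖V t‖ * ‖m t‖
        ≤ (α * (t - y) ^ 2) * ((A * Real.exp (-(t ^ 2) / 4)) * (C₀ * (1 + |t|))) := by
          rw [mul_assoc]; exact mul_le_mul hkb h2 (by positivity) (by positivity)
      _ ≤ (α * ((1 + |y|) * (1 + |t|)) ^ 2) * ((A * Real.exp (-(t ^ 2) / 4)) * (C₀ * (1 + |t|))) := by gcongr
      _ = g t := by simp only [hg, zero_mul, Real.exp_zero, mul_one]; ring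
  calc ‖∫ t in Ioi y, ((volterraKernel α (t - y) : ℂ) - (volterraKernel 0 (t - y) : ℂ)) * V t * m t‖
      ≤ ∫ t in Ioi y, g t := norm_integral_le_of_norm_le ig.integrableOn
        ((ae_restrict_iff' measurableSet_Ioi).2 (Eventually.of_forall hle))
    _ ≤ ∫ t, g t := setIntegral_le_integral ig (Eventually.of_forall fun t => by simp only [hg]; positivity)
    _ = _ := by simp only [hg]; rw [integral_const_mul]; ring

/-! ## D2. The `O(α)` bound on `m - m₀` from the weighted Volterra theory (k = 2, α-slot 0) -/

/-- **Perturbation bound.** If `m = 1 + K_α[V m]` (linear growth `C₀`) and `m₀ = 1 + K₀[V m₀]`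
(linear growth `B₀`) with the same Gaussian potential of size `A`, then `‖m - m₀‖ ≤ α K (1+|y|)²`
with `K` depending only on `A, C₀, B₀` and the `VolterraPackage 2 A` constant: `δ = m - m₀` solves
`δ = (K_α - K₀)[V m] + K₀[V δ]`, whose source is `O(α)(1+|y|)²`, and uniqueness + scaling apply.
[folklore] -/
theorem volterra_perturbation {A : ℝ} (hVP : VolterraPackage 2 A) (C₀ B₀ : ℝ) :
    ∃ K : ℝ, ∀ α : ℝ, 0 < α → α ≤ 1 → ∀ V m m₀ : ℝ → ℂ, Continuous V →
      (∀ t, ‖V t‖ ≤ A * Real.exp (-(t ^ 2) / 4)) → Continuous m → (∀ y, ‖m y‖ ≤ C₀ * (1 + |y|)) →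
      (∀ y, m y = 1 + ∫ t in Ioi y, (volterraKernel α (t - y) : ℂ) * V t * m t) →
      Continuous m₀ → (∀ y, ‖m₀ y‖ ≤ B₀ * (1 + |y|)) →
      (∀ y, m₀ y = 1 + ∫ t in Ioi y, (volterraKernel 0 (t - y) : ℂ) * V t * m₀ t) →
      ∀ y, ‖m y - m₀ y‖ ≤ α * K * (1 + |y|) ^ 2 := by
  obtain ⟨C, hP⟩ := hVP
  set M₃ : ℝ := ∫ t, (1 + |t|) ^ 3 * Real.exp (0 * t) * Real.exp (-(t ^ 2) / 4) with hM₃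
  have hM₃ : 0 ≤ M₃ := integral_nonneg fun t => by positivity
  set G₀ : ℝ := (|A| * |C₀| + 1) * (M₃ + 1) with hG₀
  have hG₀pos : 0 < G₀ := by positivity
  refine ⟨G₀ * |C|, fun α hα hα1 V m m₀ hVc hV cm hmb hmeq cm₀ hm₀b hm₀eq => ?_⟩
  have hA : 0 ≤ A := by
    have := (norm_nonneg _).trans (hV 0); simpa using this
  have hC₀ : 0 ≤ C₀ := by
    have := (norm_nonneg _).trans (hmb 0); simpa using this
  have hB₀ : 0 ≤ B₀ := by
    have := (norm_nonneg _).trans (hm₀b 0); simpa using this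
  have hmb' : ∀ y, ‖m y‖ ≤ C₀ * (1 + |y|) ^ 1 := fun y => by simpa using hmb y
  have hm₀b' : ∀ y, ‖m₀ y‖ ≤ B₀ * (1 + |y|) ^ 1 := fun y => by simpa using hm₀b y
  -- `δ = m - m₀` and its normalisation
  set c : ℝ := α * G₀ with hc
  have hcpos : 0 < c := by positivity
  set δ : ℝ → ℂ := fun y => m y - m₀ y with hδ
  have cδ : Continuous δ := cm.sub cm₀
  have hδb : ∀ y, ‖δ y‖ ≤ (C₀ + B₀) * (1 + |y|) ^ 1 := by
    intro y
    rw [pow_one]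
    calc ‖δ y‖ ≤ ‖m y‖ + ‖m₀ y‖ := norm_sub_le _ _
      _ ≤ C₀ * (1 + |y|) + B₀ * (1 + |y|) := add_le_add (hmb y) (hm₀b y)
      _ = _ := by ring
  -- the source `S₀ = δ - K₀[V δ] = (K_α - K₀)[V m]`
  set S₀ : ℝ → ℂ := fun y => δ y - ∫ t in Ioi y, (volterraKernel 0 (t - y) : ℂ) * V t * δ t with hS₀
  have cS₀ : Continuous S₀ := cδ.sub (continuous_K0 hVc hV cδ hδb)
  have hS₀eq : ∀ y, S₀ y = ∫ t in Ioi y, ((volterraKernel α (t - y) : ℂ) - (volterraKernel 0 (t - y) : ℂ)) * V t * m t := by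
    intro y
    have iα := integrableOn_kernel_mul hα.le hVc hV cm hmb' y
    have i0 := integrableOn_kernel_mul le_rfl hVc hV cm hmb' y
    have i00 := integrableOn_kernel_mul le_rfl hVc hV cm₀ hm₀b' y
    have e1 : ∫ t in Ioi y, (volterraKernel 0 (t - y) : ℂ) * V t * δ t =
        (∫ t in Ioi y, (volterraKernel 0 (t - y) : ℂ) * V t * m t) -
          ∫ t in Ioi y, (volterraKernel 0 (t - y) : ℂ) * V t * m₀ t := by
      rw [← integral_sub i0 i00]
      refine setIntegral_congr_fun measurableSet_Ioi (fun t _ => ?_)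
      simp only [hδ]; ring
    have e2 : ∫ t in Ioi y, ((volterraKernel α (t - y) : ℂ) - (volterraKernel 0 (t - y) : ℂ)) * V t * m t =
        (∫ t in Ioi y, (volterraKernel α (t - y) : ℂ) * V t * m t) -
          ∫ t in Ioi y, (volterraKernel 0 (t - y) : ℂ) * V t * m t := by
      rw [← integral_sub iα i0]
      refine setIntegral_congr_fun measurableSet_Ioi (fun t _ => ?_)
      ring
    simp only [hS₀, hδ]
    rw [e1, e2, hmeq y, hm₀eq y]
    ring
  have hS₀b : ∀ y, ‖S₀ y‖ ≤ c * (1 + |y|) ^ 2 := by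
    intro y
    rw [hS₀eq y]
    refine (norm_kernel_diff_le hα.le hV hmb y).trans ?_
    rw [hc, hG₀]
    have h1 : A * C₀ * M₃ ≤ (|A| * |C₀| + 1) * (M₃ + 1) := by
      rw [abs_of_nonneg hA, abs_of_nonneg hC₀]; nlinarith [mul_nonneg hA hC₀]
    have h2 : 0 ≤ α * (1 + |y|) ^ 2 := by positivity
    nlinarith
  -- the normalised source and the normalised `δ`
  set g : ℝ → ℂ := fun y => S₀ y / c with hg
  have cg : Continuous g := cS₀.div_const _
  have hgb : ∀ y, ‖g y‖ ≤ (1 + |y|) ^ 2 := by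
    intro y
    rw [hg]; dsimp only
    rw [norm_div, Complex.norm_real, Real.norm_of_nonneg hcpos.le, div_le_iff₀ hcpos]
    linarith [hS₀b y]
  obtain ⟨⟨mt, cmt, hmtb, hmteq⟩, huniq⟩ := hP 0 le_rfl zero_le_one V hVc hV g cg hgb
  set δ' : ℝ → ℂ := fun y => δ y / c with hδ'
  have cδ' : Continuous δ' := cδ.div_const _
  have hδ'b : ∃ B : ℝ, ∀ y, ‖δ' y‖ ≤ B * (1 + |y|) ^ 2 := by
    refine ⟨(C₀ + B₀) / c, fun y => ?_⟩
    rw [hδ']; dsimp only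
    rw [norm_div, Complex.norm_real, Real.norm_of_nonneg hcpos.le, div_mul_eq_mul_div, div_le_div_iff_of_pos_right hcpos]
    refine (hδb y).trans ?_
    rw [pow_one]
    have : (1 : ℝ) + |y| ≤ (1 + |y|) ^ 2 := by nlinarith [abs_nonneg y]
    exact mul_le_mul_of_nonneg_left this (by positivity)
  have hδ'eq : ∀ y, δ' y = g y + ∫ t in Ioi y, (volterraKernel 0 (t - y) : ℂ) * V t * δ' t := by
    intro y
    have e : (fun t => (volterraKernel 0 (t - y) : ℂ) * V t * δ' t) =
        fun t => ((volterraKernel 0 (t - y) : ℂ) * V t * δ t) / c := by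
      funext t; simp only [hδ']; ring
    rw [e, integral_div]
    simp only [hδ', hg, hS₀]
    ring
  have key := huniq δ' mt cδ' cmt hδ'b ⟨C, hmtb⟩ hδ'eq hmteq
  intro y
  have e1 : m y - m₀ y = (c : ℂ) * δ' y := by
    simp only [hδ', hδ]; field_simp [hcpos.ne']
  rw [e1, key, norm_mul, Complex.norm_real, Real.norm_of_nonneg hcpos.le]
  calc c * ‖mt y‖ ≤ c * (C * (1 + |y|) ^ 2) := by gcongr; exact hmtb y
    _ ≤ c * (|C| * (1 + |y|) ^ 2) := by gcongr; exact le_abs_self C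
    _ = α * (G₀ * |C|) * (1 + |y|) ^ 2 := by rw [hc]; ring

/-! ## D3. The registered stub: the vortex-sheet limit of the sheet coefficient -/

/-- `‖e^{-t²/2} f(t)‖` inherits the polynomial bound of `f` in Gaussian-dominated form. [folklore] -/
theorem norm_gauss_mul_le {B : ℝ} {f : ℝ → ℂ} {k : ℕ} (hfb : ∀ t, ‖f t‖ ≤ B * (1 + |t|) ^ k) (t : ℝ) :
    ‖(Real.exp (-(t ^ 2) / 2) : ℂ) * f t‖ ≤ B * ((1 + |t|) ^ k * Real.exp (0 * t) * Real.exp (-(t ^ 2) / 4)) := by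
  rw [norm_mul, Complex.norm_real, Real.norm_of_nonneg (Real.exp_pos _).le, zero_mul, Real.exp_zero, mul_one]
  have hB : 0 ≤ B * (1 + |t|) ^ k := (norm_nonneg _).trans (hfb t)
  have h2 : Real.exp (-(t ^ 2) / 2) ≤ Real.exp (-(t ^ 2) / 4) := Real.exp_le_exp.2 (by nlinarith [sq_nonneg t])
  calc Real.exp (-(t ^ 2) / 2) * ‖f t‖ ≤ Real.exp (-(t ^ 2) / 4) * (B * (1 + |t|) ^ k) :=
        mul_le_mul h2 (hfb t) (norm_nonneg _) (Real.exp_pos _).le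
    _ = _ := by ring

/-- On the disc: `‖λ‖ ≤ 5U₊/4`. [folklore] -/
theorem norm_le_of_mem_disc {lam : ℂ} (hlam : lam ∈ disc) : ‖lam‖ ≤ 5 * Uinf / 4 := by
  have hU := Uinf_pos
  have h1 : ‖lam - Uinf‖ ≤ Uinf / 4 := by
    have := hlam
    rwa [disc, mem_closedBall, dist_eq_norm] at this
  calc ‖lam‖ = ‖(lam - Uinf) + Uinf‖ := by rw [sub_add_cancel]
    _ ≤ ‖lam - Uinf‖ + ‖(Uinf : ℂ)‖ := norm_add_le _ _
    _ ≤ Uinf / 4 + Uinf := by rw [Complex.norm_real, Real.norm_of_nonneg hU.le]; linarith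
    _ = 5 * Uinf / 4 := by ring

/-- On the disc: `sheetEvans λ (λ - iU₊) = (λ + iU₊) - i · 2λU₊/(λ + iU₊)`. [folklore] -/
theorem sheetEvans_mul {lam : ℂ} (hlam : lam ∈ disc) :
    sheetEvans lam * (lam - I * Uinf) = (lam + I * Uinf) - I * (2 * lam * Uinf / (lam + I * Uinf)) := by
  have hre0 : 0 < lam.re := lt_of_lt_of_le (by have := Uinf_pos; positivity) (re_ge_of_mem_disc hlam)
  have hD : lam + I * Uinf ≠ 0 := add_I_mul_ne_zero hre0 Uinf
  have hsq : lam ^ 2 + (Uinf : ℂ) ^ 2 ≠ 0 := by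
    have h := norm_sq_add_sq_ge hlam
    have hU := Uinf_pos
    intro h0
    rw [h0, norm_zero] at h
    nlinarith
  have hprod : (lam - I * Uinf) * (lam + I * Uinf) = lam ^ 2 + (Uinf : ℂ) ^ 2 := by
    ring_nf; rw [Complex.I_sq]; ring
  apply mul_right_cancel₀ hD
  have e1 : sheetEvans lam * (lam - I * Uinf) * (lam + I * Uinf) = lam ^ 2 - (Uinf : ℂ) ^ 2 := by
    rw [sheetEvans, mul_assoc, hprod, div_mul_cancel₀ _ hsq]
  have e2 : ((lam + I * Uinf) - I * (2 * lam * Uinf / (lam + I * Uinf))) * (lam + I * Uinf) =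
      lam ^ 2 - (Uinf : ℂ) ^ 2 := by
    rw [sub_mul, mul_assoc, div_mul_cancel₀ _ hD]
    ring_nf; rw [Complex.I_sq]; ring
  rw [e1, e2]

/-- **Registered stub `stub_sheetLimit`: the vortex-sheet (long-wave) limit.** For every growth
constant `C₀` and accuracy `ε` there is `α₁ ∈ (0,1]` such that every `h = 0` slow mode with
`α ≤ α₁`, `λ` in the disc and `‖e^{αy}ψ‖ ≤ C₀(1+|y|)` has `‖sheetCoeff α ψ - sheetEvans λ‖ ≤ ε`.
Proof: with `m = e^{αy}ψ`, `V = iU''/(λ+iU)`, the exact Wronskian identity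
`a(λ - iU₊) = (λ + iU₊) - i∫U'm` (`slowMode_sheet`) and `∫U'm₀ = 2λU₊/(λ+iU₊)` for
`m₀ = (λ+iU)/(λ+iU₊)` give `a - sheetEvans λ = -i∫U'(m - m₀)/(λ - iU₊)`, and
`‖m - m₀‖ ≤ αK(1+|y|)²` by the weighted Volterra theory (`volterra_perturbation`). [folklore] -/
theorem stub_sheetLimit : (∀ k : ℕ, 1 ≤ k → ∀ A : ℝ, VolterraPackage k A) → ∀ C₀ : ℝ, 0 < C₀ → ∀ ε : ℝ, 0 < ε → SheetLimitPackage C₀ ε := by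
  intro hVP C₀ _hC₀ ε hε
  have hU := Uinf_pos
  set A : ℝ := 1 / (3 * Uinf / 4) with hA
  set B₀ : ℝ := (5 * Uinf / 4 + 1) / (3 * Uinf / 4) with hB₀
  obtain ⟨K, hK⟩ := volterra_perturbation (hVP 2 (by norm_num) A) C₀ B₀
  set M₂ : ℝ := ∫ t, (1 + |t|) ^ 2 * Real.exp (0 * t) * Real.exp (-(t ^ 2) / 4) with hM₂
  have hM₂ : 0 ≤ M₂ := integral_nonneg fun t => by positivity
  set Kf : ℝ := A * (|K| * M₂) + 1 with hKf
  have hKfpos : 0 < Kf := by positivity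
  refine ⟨min 1 (ε / Kf), lt_min one_pos (div_pos hε hKfpos), min_le_left _ _, ?_⟩
  intro α hα hα1 lam hlam ψ hψ hgrowth
  have hαle1 : α ≤ 1 := hα1.trans (min_le_left _ _)
  have hαε : α * Kf ≤ ε := by
    have := hα1.trans (min_le_right _ _)
    rwa [le_div_iff₀ hKfpos] at this
  have hre : 3 * Uinf / 4 ≤ lam.re := re_ge_of_mem_disc hlam
  have hre0 : 0 < lam.re := lt_of_lt_of_le (by positivity) hre
  have hAre : 1 / lam.re ≤ A := one_div_le_one_div_of_le (by positivity) hre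
  -- the slow-mode package for `m = e^{αy}ψ`
  obtain ⟨cm, hmeq, hsheet⟩ := slowMode_sheet hα hre0 hψ hgrowth
  set m : ℝ → ℂ := fun y => (Real.exp (α * y) : ℂ) * ψ y with hm
  set V : ℝ → ℂ := fun y => I * (Upp y : ℂ) / (lam + I * (U y : ℂ)) with hV
  set m₀ : ℝ → ℂ := fun y => (lam + I * (U y : ℂ)) / (lam + I * Uinf) with hm₀
  have hVA : ∀ t, ‖V t‖ ≤ A * Real.exp (-(t ^ 2) / 4) := fun t =>
    (norm_V_le hre0 t).trans (mul_le_mul_of_nonneg_right hAre (Real.exp_pos _).le)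
  have cm₀ : Continuous m₀ := by simp only [hm₀]; have := Strained.differentiable_U.continuous; fun_prop
  have hm₀b : ∀ y, ‖m₀ y‖ ≤ B₀ * (1 + |y|) := by
    intro y
    refine (norm_m0_le hre0 y).trans (mul_le_mul_of_nonneg_right ?_ (by positivity))
    exact div_le_div₀ (by positivity) (by linarith [norm_le_of_mem_disc hlam]) (by positivity) hre
  have hm₀eq : ∀ y, m₀ y = 1 + ∫ t in Ioi y, (volterraKernel 0 (t - y) : ℂ) * V t * m₀ t :=
    fun y => m0_volterra hre0 y
  -- the `O(α)` bound on `m - m₀`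
  have hδ := hK α hα hαle1 V m m₀ (continuous_V hre0) hVA cm hgrowth hmeq cm₀ hm₀b hm₀eq
  -- the two identities and their difference
  have iUm : Integrable fun t => (Real.exp (-(t ^ 2) / 2) : ℂ) * m t :=
    integrable_of_norm_le_polyGauss (Continuous.aestronglyMeasurable (by fun_prop)) C₀ 1 0
      (norm_gauss_mul_le fun t => by rw [pow_one]; exact hgrowth t)
  have iUm₀ : Integrable fun t => (Real.exp (-(t ^ 2) / 2) : ℂ) * m₀ t :=
    integrable_of_norm_le_polyGauss (Continuous.aestronglyMeasurable (by fun_prop)) B₀ 1 0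
      (norm_gauss_mul_le fun t => by rw [pow_one]; exact hm₀b t)
  have hD' : lam - I * Uinf ≠ 0 := sub_I_mul_Uinf_ne_zero hre0
  have hEv : sheetEvans lam * (lam - I * Uinf) =
      (lam + I * Uinf) - I * ∫ t, (Real.exp (-(t ^ 2) / 2) : ℂ) * m₀ t := by
    rw [sheetEvans_mul hlam, integral_gauss_mul_m0 hre0]
  have hdiff : sheetCoeff α ψ - sheetEvans lam =
      (-I * ∫ t, (Real.exp (-(t ^ 2) / 2) : ℂ) * (m t - m₀ t)) * (lam - I * Uinf)⁻¹ := by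
    have e : ∫ t, (Real.exp (-(t ^ 2) / 2) : ℂ) * (m t - m₀ t) =
        (∫ t, (Real.exp (-(t ^ 2) / 2) : ℂ) * m t) - ∫ t, (Real.exp (-(t ^ 2) / 2) : ℂ) * m₀ t := by
      rw [← integral_sub iUm iUm₀]
      congr 1; funext t; ring
    have h2 : (sheetCoeff α ψ - sheetEvans lam) * (lam - I * Uinf) =
        -I * ∫ t, (Real.exp (-(t ^ 2) / 2) : ℂ) * (m t - m₀ t) := by
      rw [e, sub_mul, hsheet, hEv]; ring
    rw [← h2, mul_inv_cancel_right₀ hD']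
  -- the estimate
  have hint : ‖∫ t, (Real.exp (-(t ^ 2) / 2) : ℂ) * (m t - m₀ t)‖ ≤ α * |K| * M₂ := by
    calc ‖∫ t, (Real.exp (-(t ^ 2) / 2) : ℂ) * (m t - m₀ t)‖
        ≤ ∫ t, α * |K| * ((1 + |t|) ^ 2 * Real.exp (0 * t) * Real.exp (-(t ^ 2) / 4)) := by
          refine norm_integral_le_of_norm_le ((integrable_polyGauss 2 0).const_mul _)
            (Eventually.of_forall fun t => ?_)
          refine (norm_gauss_mul_le hδ t).trans ?_
          gcongr
          exact le_abs_self K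
      _ = α * |K| * M₂ := integral_const_mul _ _
  rw [hdiff, norm_mul, norm_mul, norm_neg, Complex.norm_I, one_mul]
  calc ‖∫ t, (Real.exp (-(t ^ 2) / 2) : ℂ) * (m t - m₀ t)‖ * ‖(lam - I * Uinf)⁻¹‖
      ≤ (α * |K| * M₂) * A :=
        mul_le_mul hint ((norm_inv_sub_I_mul_Uinf_le hre0).trans hAre) (norm_nonneg _) (by positivity)
    _ ≤ α * Kf := by
        rw [hKf]
        nlinarith [mul_nonneg hα.le (mul_nonneg (abs_nonneg K) hM₂)]
    _ ≤ ε := hαε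

end Summit.AnomalousDissipation.AnomalousDissipation.Theorems.BurgersLayerKH.Sheet.SheetLimit

end
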